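import Summits.BirchSwinnertonDyer.Rank1Residual.GaloisImage.ExoticNoTransversalDepthTwo
import Summits.BirchSwinnertonDyer.BirchSwinnertonDyer.Theorems.KimAtThreeKolyvaginCertificateDictionary
import HarnessLib

/-!
# The deep-limit invariants DEGENERATE off the `3`-adic tower: on an EXOTIC row (`ρ̄_{E,3}` onto,
# `ρ̄_{E,9}` not onto) `∂^{(∞)}_deep(δ̃) = ∂⁽⁰⁾(δ̃)`, so the conclusion of crux `DeepLowerAtThree` holds
# there trivially and that of `DeepUpperAtThree` reads `3 ∤ #Ш(E/ℚ)[3^∞]` — tightness of the tower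
# binder of items 19075/19076 (route W2 `KimAtThreeKolyvagin`, cell `bsd-addord`, seat w2-c2, D-0074 B5)

HONEST FRAMING. Theorems only (no definition, no named fact, no `sorry`); unconditional; nothing booked;
cruxes 19075/19076 stay OPEN and are NOT weakened — both carry the tower binder
`∀ n, W.HasSurjectiveModNGaloisRep (3^n)`, which EXCLUDES the rows treated here. This file records,
in the kernel, WHY that binder is load-bearing for the deep-limit typing (`KuriharaNumberDeepInvariants`,
Mazur–Rubin Def. 4.5.7 / 5.2.11 shape): cell b2b/n1011 + cc-typer-1 proved that on an exotic row no
Kolyvagin prime of depth `2` is transversal (`three_lt_natCard_torsion_intModel_of_exotic`), hence the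
only CYCLIC level in `𝒩₂(E,3)` is `n = 1` (`eq_one_of_isKolyvaginProduct_two_of_isCyclicKolyvaginLevel_of_exotic`,
Elkies' `9`-deficient image, `ExoticNoLevelTwoTau`). Consequently:

* `kuriharaPartialDeepAt_three_eq_top_of_exotic` — `∂⁽ⁱ⁾(δ̃^{(k)}) = ⊤` for `k ≥ 2`, `i ≥ 1` (empty
  stratum); `kuriharaPartialDeep_three_eq_top_of_exotic` — `∂⁽ⁱ⁾_deep(δ̃) = ⊤` for `i ≥ 1`;
* `kuriharaPartialDeep_zero_eq_kuriharaPartial_zero` (general `W`, `p`) — `∂⁽⁰⁾_deep = ∂⁽⁰⁾`;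
* `kuriharaPartialDeepInfty_three_eq_kuriharaPartial_zero_of_exotic` — `∂^{(∞)}_deep(δ̃) = ∂⁽⁰⁾(δ̃)` for
  EVERY cusp form `f` on an exotic row;
* `deepLower_conclusion_of_exotic` — the conclusion of item 19075 holds on exotic rows with
  `ord(δ̃) = 0` for free (`d = ∂⁽⁰⁾`): were the tower binder dropped, these rows would join vacuously;
* `deepUpper_conclusion_iff_of_exotic` — the conclusion of item 19076 on an exotic row with
  `ord(δ̃) = 0` is EQUIVALENT to `ord₃ #Ш(E/ℚ)(3) = 0`: without the tower the Kato-side crux would be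
  false on every exotic row with `3 ∣ #Ш` (contrast: under the tower every `𝒩_k`-stratum is non-empty,
  `KimAtThreeDeepLowerLevelSupply.kuriharaPartialDeepAt_three_le_of_towerSurj`, p418564).
The 21 exotic (Elkies) curves are board row B7, outside the N11 leaf; nothing here bears on them beyond
this bookkeeping.

References: B. Mazur, K. Rubin, Mem. AMS 799 (2004) Def. 4.5.7, Def. 5.2.11 [MazurRubin2004];
C.-H. Kim, AJM 148 (2026) §1.2.2, §1.5.1, Thm. 2.1 [Kim2022StructureSelmer]; N. Elkies, arXiv:math/0612734
(the `9`-deficient `3`-adic image) [Elkies2006]; R. Sakamoto, JTNB 36 (2024) §2 (H.2) [Sakamoto2024].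
-/

-- the Theorems namespace of a single-conjunct summit repeats the summit name by design (D-0017)
set_option linter.dupNamespace false

noncomputable section

open scoped Classical
open WeierstrassCurve CongruenceSubgroup Literature.NumberTheory.EllipticCurves
  Literature.NumberTheory.EllipticCurves.ModularForms
  Summit.BirchSwinnertonDyer.Rank1Residual.GaloisImage
  Summit.BirchSwinnertonDyer.BirchSwinnertonDyer.Theorems.KimAtThreeKolyvaginUnitLevelOneRungs
  Summit.BirchSwinnertonDyer.BirchSwinnertonDyer.Theorems.KimAtThreeKolyvaginCertificateDictionary

namespace Summit.BirchSwinnertonDyer.BirchSwinnertonDyer.Theorems.KimAtThreeDeepLowerExoticRows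

section General

variable (W : WeierstrassCurve ℚ) [W.IsGloballyMinimal] (p : ℕ) {N : ℕ} (f : CuspForm (Gamma0 N) 2)

/-- **`∂⁽⁰⁾_deep(δ̃) = ∂⁽⁰⁾(δ̃)`** for every `W`, `p`, `f`: the level `n = 1` is the only level with no prime
factor, it is cyclic and lies in every `𝒩_k`, so both sides are `ord_p δ̃_1`
(`kuriharaPartialDeep_zero_le_kuriharaDivIndex_one`, `kuriharaPartial_le_kuriharaPartialDeep`,
`kuriharaPartial_zero`). [cite: MazurRubin2004, Def. 4.5.7 and Def. 5.2.11] [cite: Kim2022StructureSelmer, §1.5.1 (PDF p. 7)] -/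
theorem kuriharaPartialDeep_zero_eq_kuriharaPartial_zero :
    kuriharaPartialDeep W p f 0 = kuriharaPartial W p f 0 :=
  le_antisymm (by rw [kuriharaPartial_zero]; exact kuriharaPartialDeep_zero_le_kuriharaDivIndex_one W p f)
    (kuriharaPartial_le_kuriharaPartialDeep W p f 0)

end General

section Exotic

variable (W : WeierstrassCurve ℚ) [W.IsElliptic] [W.IsGloballyMinimal] {N : ℕ}
  (f : CuspForm (Gamma0 N) 2)

/-- **On an exotic row `∂⁽ⁱ⁾(δ̃^{(k)}) = ⊤` for every depth `k ≥ 2` and every `i ≥ 1`**: a cyclic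
Kolyvagin level in `𝒩_k(E,3) ⊆ 𝒩₂(E,3)` is `n = 1`
(`eq_one_of_isKolyvaginProduct_two_of_isCyclicKolyvaginLevel_of_exotic`), which has no prime factor,
so the infimum is over the empty stratum. [cite: Kim2022StructureSelmer, §1.2.2 and Thm. 2.1]
[cite: MazurRubin2004, Def. 4.5.7] -/
theorem kuriharaPartialDeepAt_three_eq_top_of_exotic (hsurj : W.HasSurjectiveModNGaloisRep 3)
    (hns9 : ¬ W.HasSurjectiveModNGaloisRep 9) {k i : ℕ} (hk : 2 ≤ k) (hi : 1 ≤ i) :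
    kuriharaPartialDeepAt W 3 f k i = ⊤ := by
  rw [kuriharaPartialDeepAt_def]
  refine iInf_eq_top.mpr fun n => iInf_eq_top.mpr fun hcyc => iInf_eq_top.mpr fun hkn =>
    iInf_eq_top.mpr fun hcard => ?_
  have h1 : n = 1 :=
    eq_one_of_isKolyvaginProduct_two_of_isCyclicKolyvaginLevel_of_exotic W hsurj hns9 (hkn.mono hk) hcyc
  subst h1
  rw [Nat.primeFactors_one, Finset.card_empty] at hcard
  omega

/-- **On an exotic row `∂⁽ⁱ⁾_deep(δ̃) = ⊤` for every `i ≥ 1`** (the supremum over `k` contains the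
`k = 2` term `⊤`). [cite: MazurRubin2004, Def. 5.2.11 and Thm. 5.2.12 (i)] -/
theorem kuriharaPartialDeep_three_eq_top_of_exotic (hsurj : W.HasSurjectiveModNGaloisRep 3)
    (hns9 : ¬ W.HasSurjectiveModNGaloisRep 9) {i : ℕ} (hi : 1 ≤ i) :
    kuriharaPartialDeep W 3 f i = ⊤ := by
  refine top_le_iff.mp ?_
  rw [← kuriharaPartialDeepAt_three_eq_top_of_exotic W f hsurj hns9 le_rfl hi]
  exact kuriharaPartialDeepAt_le_kuriharaPartialDeep W 3 f 2 i

/-- **On an exotic row the deep limit collapses to `∂⁽⁰⁾`: `∂^{(∞)}_deep(δ̃) = ∂⁽⁰⁾(δ̃)`** for every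
weight-`2` cusp form `f` (`i = 0` term `∂⁽⁰⁾`, all other terms `⊤`). [cite: MazurRubin2004, Def. 5.2.11]
[cite: Kim2022StructureSelmer, §1.5.1 (PDF p. 7)] -/
theorem kuriharaPartialDeepInfty_three_eq_kuriharaPartial_zero_of_exotic
    (hsurj : W.HasSurjectiveModNGaloisRep 3) (hns9 : ¬ W.HasSurjectiveModNGaloisRep 9) :
    kuriharaPartialDeepInfty W 3 f = kuriharaPartial W 3 f 0 := by
  refine le_antisymm (kuriharaPartialDeepInfty_le_kuriharaPartial_zero W 3 f) (le_iInf fun i => ?_)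
  rcases Nat.eq_zero_or_pos i with rfl | hi
  · rw [kuriharaPartialDeep_zero_eq_kuriharaPartial_zero]
  · rw [kuriharaPartialDeep_three_eq_top_of_exotic W f hsurj hns9 hi]
    exact le_top

/-- **The conclusion of item 19075 (`DeepLowerAtThree`) holds on every exotic row with `ord(δ̃) = 0`,
for free** (`d = ∂⁽⁰⁾(δ̃)`, finite in analytic rank `0`): the tower binder of the crux is not what makes
the LOWER inequality true there — it is what makes it non-vacuous.
[cite: Kim2022StructureSelmer, §1.4.4 and §1.5.1 (PDF p. 7)] [cite: MazurRubin2004, Def. 5.2.11] -/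
theorem deepLower_conclusion_of_exotic (hsurj : W.HasSurjectiveModNGaloisRep 3)
    (hns9 : ¬ W.HasSurjectiveModNGaloisRep 9) (hord : kuriharaVanishingOrder W 3 f = 0) :
    ∃ d : ℕ, kuriharaPartialDeepInfty W 3 f = d ∧
      kuriharaPartial W 3 f 0 ≤
        ((padicValNat 3 (Nat.card (AddCommGroup.primaryComponent W.sha 3)) + d : ℕ) : ℕ∞) := by
  have hfin : kuriharaPartial W 3 f 0 < ⊤ := by
    rw [kuriharaPartial_zero]
    exact kuriharaDivIndex_one_lt_top_of_kuriharaVanishingOrder_eq_zero W 3 f hord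
  obtain ⟨a, ha⟩ := ENat.ne_top_iff_exists.mp hfin.ne
  refine ⟨a, ?_, ?_⟩
  · rw [kuriharaPartialDeepInfty_three_eq_kuriharaPartial_zero_of_exotic W f hsurj hns9, ha]
  · rw [← ha]
    exact_mod_cast Nat.le_add_left a _

/-- **Tightness of the tower binder of item 19076 (`DeepUpperAtThree`)**: on an exotic row with
`ord(δ̃) = 0` its conclusion `∃ d, ∂^{(∞)}_deep = d ∧ ord₃ #Ш(3) + d ≤ ∂⁽⁰⁾` is EQUIVALENT to
`ord₃ #Ш(E/ℚ)(3) = 0` — it would be false on every exotic row with `3 ∣ #Ш[3^∞]`.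
[cite: MazurRubin2004, Def. 5.2.11 and Thm. 5.2.12] [cite: Kim2022StructureSelmer, Thm. 1.9 (6) (PDF p. 8)] -/
theorem deepUpper_conclusion_iff_of_exotic (hsurj : W.HasSurjectiveModNGaloisRep 3)
    (hns9 : ¬ W.HasSurjectiveModNGaloisRep 9) (hord : kuriharaVanishingOrder W 3 f = 0) :
    (∃ d : ℕ, kuriharaPartialDeepInfty W 3 f = d ∧
      ((padicValNat 3 (Nat.card (AddCommGroup.primaryComponent W.sha 3)) + d : ℕ) : ℕ∞) ≤
        kuriharaPartial W 3 f 0) ↔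
    padicValNat 3 (Nat.card (AddCommGroup.primaryComponent W.sha 3)) = 0 := by
  have hfin : kuriharaPartial W 3 f 0 < ⊤ := by
    rw [kuriharaPartial_zero]
    exact kuriharaDivIndex_one_lt_top_of_kuriharaVanishingOrder_eq_zero W 3 f hord
  obtain ⟨a, ha⟩ := ENat.ne_top_iff_exists.mp hfin.ne
  have hdeep : kuriharaPartialDeepInfty W 3 f = a :=
    (kuriharaPartialDeepInfty_three_eq_kuriharaPartial_zero_of_exotic W f hsurj hns9).trans ha.symm
  constructor
  · rintro ⟨d, hd, hle⟩
    have hda : d = a := by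
      rw [hdeep] at hd
      exact_mod_cast hd.symm
    subst hda
    rw [← ha] at hle
    have hle' : padicValNat 3 (Nat.card (AddCommGroup.primaryComponent W.sha 3)) + d ≤ d := by
      exact_mod_cast hle
    omega
  · intro hs
    refine ⟨a, hdeep, ?_⟩
    rw [hs, zero_add, ha]

end Exotic

end Summit.BirchSwinnertonDyer.BirchSwinnertonDyer.Theorems.KimAtThreeDeepLowerExoticRows

end
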